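import Mathlib
import Literature.Analysis.FluidPDE.ClassicalSolutionRescale
import Summits.NavierStokesRegularity.NavierStokesRegularity.Theorems.LandauTailLandauTailBlowupLandau
import Summits.NavierStokesRegularity.NavierStokesRegularity.Theorems.LandauTailLandauTailBlowupTypeIIPrep
import Summits.NavierStokesRegularity.NavierStokesRegularity.Theorems.LandauTailLandauTailBlowupVitali
import Summits.NavierStokesRegularity.NavierStokesRegularity.Theorems.LandauTailLandauTailBlowupFluxIntegral
import Summits.NavierStokesRegularity.NavierStokesRegularity.Theorems.LandauTailLandauTailBlowupDivFreeTest
import Summits.NavierStokesRegularity.NavierStokesRegularity.Theorems.LandauTailLandauTailBlowupLandauFlux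

/-!
# The momentum-flux engine: no `L^q`-bounded sequence of classical flows can converge to a Landau flow

Helper file for the crux item `stmt-NavierStokesRegularity-1944` (`LandauTail.LandauTailBlowup`, line
`registered`), cycle c5. It isolates the core of the proof of the Type-II theorem
`landauTail_scaledNorm_tendsto_top` (`LandauTailLandauTailBlowupTypeII`) as a reusable engine:

* `landauTail_false_of_rescalings_Lq_bounded` (registered support stub) — **the engine.** Let `(U, P)`
  be a nonzero steady `(−1)`-homogeneous Navier–Stokes profile smooth off the origin (a Landau solution by
  Šverák's theorem) and let `(w n, π n)` be classical unit-viscosity solutions of the unforced system on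
  `ℝ³ × (−1, 0)` converging pointwise off the time axis to the STEADY field `U`
  (`w n τ y → U y` for every `τ ∈ (−1,0)`, `y ≠ 0`). Then for no `q ∈ (2, 3)` can the `w n` be bounded in
  `L^q(Q₁)`, `Q₁ = (−1,0) × B₁`. Proof: Vitali (`landauTail_tendsto_eLpNorm_two_of_eLpNorm_le`) upgrades
  the convergence to `L²(Q₁)`; the very weak Navier–Stokes identity of the `w n` passes to the limit for
  tests supported in `Q₁` (`landauTail_veryWeak_of_tendsto_L2`), so for the test fields `θ(t) φ(x)` one
  gets `(∫θ) ∫(⟪U,(U·∇)φ⟫ + ⟪U,Δφ⟫) = 0` (`landauTail_veryWeak_smul_eq`); with Šverák's normal form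
  `U = landauAxisField a A`, the solenoidal `φ` with `φ(0) = a` and the Landau flux identity the integral is
  `−β(A) < 0` — contradiction. Every blow-up/zoom sequence of a Landau-tailed solution feeds this engine
  (the Type-II theorem for the cylinders `Q_r(0,0)`; the slice theorem for the core balls `B_{√(−t)}`).

References: L. D. Landau (1944); P. G. Lemarié-Rieusset (2016), (10.48); D. Chae, Math. Ann. 338 (2007),
proof of Thm 1.5; G. Koch, N. Nadirashvili, G. Seregin, V. Šverák, Acta Math. 203 (2009), §4 (ii).
-/

noncomputable section

open Filter Set Topology MeasureTheory Metric Function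
open scoped ENNReal NNReal InnerProductSpace RealInnerProductSpace Laplacian ContDiff
open Literature.Analysis.FluidPDE

-- the summit-side namespace repeats a component by design (D-0017)
set_option linter.dupNamespace false

namespace Summit.NavierStokesRegularity.NavierStokesRegularity.Theorems

/-- **The momentum-flux engine** (registered support stub of crux stmt-NavierStokesRegularity-1944):
classical unit-viscosity flows on `ℝ³ × (−1,0)` that converge pointwise off the time axis to a nonzero
steady `(−1)`-homogeneous Navier–Stokes profile (a Landau flow) are unbounded in `L^q((−1,0) × B₁)` for
every `q ∈ (2,3)`: otherwise the steady Landau flow would solve Navier–Stokes across the origin in the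
very weak sense, contradicting its nonzero point momentum flux `β(A) a` (Landau 1944; Lemarié-Rieusset
2016 (10.48); the limit is Chae 2007, p. 8). -/
theorem landauTail_false_of_rescalings_Lq_bounded : ∀ (w : ℕ → ℝ → EuclideanSpace ℝ (Fin 3) → EuclideanSpace ℝ (Fin 3)) (π : ℕ → ℝ → EuclideanSpace ℝ (Fin 3) → ℝ) (U : EuclideanSpace ℝ (Fin 3) → EuclideanSpace ℝ (Fin 3)) (P : EuclideanSpace ℝ (Fin 3) → ℝ), (ContDiffOn ℝ (⊤ : ℕ∞) U {0}ᶜ ∧ ContDiffOn ℝ (⊤ : ℕ∞) P {0}ᶜ ∧ (∀ x : EuclideanSpace ℝ (Fin 3), x ≠ 0 → Literature.Analysis.FluidPDE.convect U U x + gradient P x = (1 : ℝ) • Laplacian.laplacian U x) ∧ (∀ x : EuclideanSpace ℝ (Fin 3), x ≠ 0 → Literature.Analysis.FluidPDE.VectorCalculus.divergence U x = 0) ∧ (∀ c : ℝ, 0 < c → ∀ x : EuclideanSpace ℝ (Fin 3), U (c • x) = c⁻¹ • U x) ∧ (∃ x : EuclideanSpace ℝ (Fin 3), U x ≠ 0))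 → (∀ n, Literature.Analysis.FluidPDE.IsClassicalNSSolutionOn (Set.Ioo (-1) 0) 1 0 (w n) (π n)) → (∀ τ ∈ Set.Ioo (-1 : ℝ) 0, ∀ y : EuclideanSpace ℝ (Fin 3), y ≠ 0 → Filter.Tendsto (fun n => w n τ y) Filter.atTop (nhds (U y))) → ∀ q : ℝ, 2 < q → q < 3 → (∃ M : NNReal, ∀ n, ∫⁻ z in Set.Ioo (-1 : ℝ) 0 ×ˢ Metric.ball (0 : EuclideanSpace ℝ (Fin 3)) 1, ‖w n z.1 z.2‖ₑ ^ q ≤ M) → False := by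
  intro w π U P hprof hwcl hptw q hq hq3 hbd
  obtain ⟨M, hM⟩ := hbd
  obtain ⟨hUs, hPs, hNS, hdiv, hhom, hne⟩ := hprof
  have hUc : ContinuousOn U {0}ᶜ := hUs.continuousOn
  have hq0 : 0 < q := by linarith
  have hSm : MeasurableSet (Ioo (-1 : ℝ) 0 ×ˢ ball (0 : EuclideanSpace ℝ (Fin 3)) 1) :=
    measurableSet_Ioo.prod measurableSet_ball
  have hwc : ∀ n, ContinuousOn (uncurry (w n)) (Ioo (-1 : ℝ) 0 ×ˢ univ) := fun n =>
    (hwcl n).smooth_velocity.continuousOn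
  -- Step 1: the test field `θ(t) φ(x)` with `φ(0) = a`, `a` the Landau axis of `U`
  obtain ⟨a, ha, A, hA, hUeq⟩ := landauTail_exists_axis_of_profile one_pos hUs hPs hNS hdiv hhom hne
  obtain ⟨φ, hφs, hφc, hφsupp, hφdiv, hφ0⟩ := landauTail_exists_divFree_test a
  let θb : ContDiffBump (-1 / 2 : ℝ) := ⟨1 / 8, 1 / 4, by norm_num, by norm_num⟩
  have hθs : ContDiff ℝ ∞ θb := θb.contDiff
  have hθsupp : tsupport θb ⊆ Ioo (-1 : ℝ) 0 := by
    rw [θb.tsupport_eq]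
    intro t ht
    rw [mem_closedBall, Real.dist_eq, abs_le] at ht
    constructor <;> linarith [ht.1, ht.2]
  have hθK : IsCompact (tsupport θb) := by
    rw [θb.tsupport_eq]
    exact isCompact_closedBall _ _
  have hθint : 0 < ∫ t, θb t := θb.integral_pos
  set ψ : ℝ → EuclideanSpace ℝ (Fin 3) → EuclideanSpace ℝ (Fin 3) := fun t x => θb t • φ x with hψ
  have hψtest : IsSpaceTimeTestOn (parabolicCylinderOpens 1 ((0 : ℝ), (0 : EuclideanSpace ℝ (Fin 3)))) ψ :=
    landauTail_isSpaceTimeTestOn_smul hθs hθK hθsupp hφs hφc hφsupp hψ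
  have hψdiv : ∀ t, VectorCalculus.IsDivFree (ψ t) := by
    intro t x
    show VectorCalculus.divergence (fun x => θb t • φ x) x = 0
    rw [divergence_const_smul_apply (hφs.differentiable (by simp) x), hφdiv x, mul_zero]
  have hψslab : IsSpaceTimeTestOn (slab (EuclideanSpace ℝ (Fin 3)) (Ioo (-1) 0) isOpen_Ioo) ψ :=
    hψtest.mono fun z hz => by
      have hz' : z ∈ parabolicCylinder 1 ((0 : ℝ), (0 : EuclideanSpace ℝ (Fin 3))) := hz
      rw [mem_parabolicCylinder] at hz'
      refine mem_slab.2 ⟨?_, hz'.1.2⟩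
      have h1 := hz'.1.1
      norm_num at h1
      exact h1
  have hid : ∀ n, ∫ t in Ioo (-1 : ℝ) 0, ∫ x, (⟪w n t x, timeDeriv ψ t x⟫ +
      ⟪w n t x, convect (w n t) (ψ t) x⟫ + 1 * ⟪w n t x, Δ (ψ t) x⟫) = 0 := fun n =>
    (hwcl n).integral_veryWeak_eq_zero hψslab hψdiv
  -- Step 2: Vitali — `L²(Q₁)` convergence to the steady profile
  set μ : Measure (ℝ × EuclideanSpace ℝ (Fin 3)) :=
    volume.restrict (Ioo (-1 : ℝ) 0 ×ˢ ball (0 : EuclideanSpace ℝ (Fin 3)) 1) with hμ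
  haveI : IsFiniteMeasure μ := by
    refine ⟨?_⟩
    rw [hμ, Measure.restrict_apply_univ, Measure.volume_eq_prod, Measure.prod_prod, Real.volume_Ioo]
    exact ENNReal.mul_lt_top ENNReal.ofReal_lt_top measure_ball_lt_top
  set f : ℕ → ℝ × EuclideanSpace ℝ (Fin 3) → EuclideanSpace ℝ (Fin 3) := fun n z => w n z.1 z.2 with hf
  set g : ℝ × EuclideanSpace ℝ (Fin 3) → EuclideanSpace ℝ (Fin 3) := fun z => U z.2 with hg
  have hfm : ∀ n, AEStronglyMeasurable (f n) μ := fun n =>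
    ((hwc n).mono (prod_mono Subset.rfl (subset_univ _))).aestronglyMeasurable hSm
  have hbdd : ∃ C : ℝ≥0, ∀ n, eLpNorm (f n) (ENNReal.ofReal q) μ ≤ C := by
    refine ⟨M ^ (1 / q), fun n => ?_⟩
    have hq' : ENNReal.ofReal q ≠ 0 := (ENNReal.ofReal_pos.2 hq0).ne'
    rw [eLpNorm_eq_lintegral_rpow_enorm_toReal hq' ENNReal.ofReal_ne_top, ENNReal.toReal_ofReal hq0.le]
    calc (∫⁻ z, ‖f n z‖ₑ ^ q ∂μ) ^ (1 / q) ≤ (M : ℝ≥0∞) ^ (1 / q) :=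
          ENNReal.rpow_le_rpow (hM n) (by positivity)
      _ = ((M ^ (1 / q) : ℝ≥0) : ℝ≥0∞) := (ENNReal.coe_rpow_of_nonneg _ (by positivity)).symm
  have hae0 : ∀ᵐ z ∂(volume : Measure (ℝ × EuclideanSpace ℝ (Fin 3))), z.2 ≠ 0 := by
    have e : {z : ℝ × EuclideanSpace ℝ (Fin 3) | z.2 = 0} = univ ×ˢ {0} := by
      ext z
      simp
    rw [ae_iff]
    simp only [not_not]
    rw [e, Measure.volume_eq_prod, Measure.prod_prod, measure_singleton, mul_zero]
  have hfg : ∀ᵐ z ∂μ, Tendsto (fun n => f n z) atTop (𝓝 (g z)) := by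
    rw [hμ, ae_restrict_iff' hSm]
    filter_upwards [hae0] with z hz hzQ
    exact hptw z.1 hzQ.1 z.2 hz
  have hq2 : (2 : ℝ≥0∞) < ENNReal.ofReal q := by
    rw [show (2 : ℝ≥0∞) = ENNReal.ofReal 2 by norm_num]
    exact (ENNReal.ofReal_lt_ofReal_iff hq0).2 hq
  have hconv := landauTail_tendsto_eLpNorm_two_of_eLpNorm_le μ f g (ENNReal.ofReal q) hq2
    ENNReal.ofReal_ne_top hfm hbdd hfg
  -- Step 3: the steady profile satisfies the very weak identity on `Q₁`, hence `J = 0`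
  have hUm : AEStronglyMeasurable U volume := (landauTail_profile_measurable hUc).aestronglyMeasurable
  have hU2 := landauTail_eLpNorm_profile_two_lt_top hUc hhom
  have hlimit := landauTail_veryWeak_of_tendsto_L2 w U ψ hwc hψtest hψdiv hid hUm hU2 hconv
  rw [landauTail_veryWeak_smul_eq hUc hhom hθs hθsupp hφs hφc hφsupp hψ] at hlimit
  have hJ : ∫ x, (⟪U x, convect U φ x⟫ + ⟪U x, Δ φ x⟫) = 0 :=
    (mul_eq_zero.1 hlimit).resolve_left hθint.ne'
  -- Step 4: the flux of the Landau solution is not zero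
  obtain ⟨hV, hPV, hNSV, hdivV, hhomV, -⟩ := landauTail_landauAxisField_profile ha hA
  have hflux := landauTail_flux_identity (landauAxisField a A) (landauAxisPressure a A) φ hV hPV hNSV
    hdivV hhomV (fun c hc x => landauAxisPressure_smul a A hc x) hφs hφc hφdiv
  rw [hφ0, landauTail_landau_flux_eq a A ha hA, landauTail_landau_flux_integral A hA] at hflux
  have hpos := landauTail_landau_flux_pos A hA
  have hJV : ∫ x, (⟪U x, convect U φ x⟫ + ⟪U x, Δ φ x⟫) =
      ∫ x, (⟪landauAxisField a A x, convect (landauAxisField a A) φ x⟫ + ⟪landauAxisField a A x, Δ φ x⟫) := by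
    refine integral_congr_ae ?_
    filter_upwards [compl_mem_ae_iff.2 (measure_singleton (0 : EuclideanSpace ℝ (Fin 3)))] with x hx
    simp only [convect, hUeq x hx, one_smul]
  rw [hJV, hflux] at hJ
  have hπ := Real.pi_pos
  nlinarith

end Summit.NavierStokesRegularity.NavierStokesRegularity.Theorems

end
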